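import Summits.NavierStokesRegularity.NavierStokesRegularity.Theorems.AdaptedFrequencyConverges.Negative.LinearFlow

/-!
# Linear-flow witness, II: kernel variances and the anisotropic Gaussian

Negative-side support for crux `AdaptedFrequencyConverges` (stmt-NavierStokesRegularity-10493, route
`AdaptedFrequency`), cdisprove seat, cycle 1 (2026-08-16). Part of the kernel-checked proof that the crux is FALSE once
its far-field hypotheses (Leray–Hopf class, rapid decay, sup-norm Type-I) are dropped — `AdaptedFrequencyConvergesWithoutDecay`
in `…Negative.FalseWithoutDecay` — by an EXACT linear Navier–Stokes flow with an EXACT anisotropic Gaussian adapted kernel whose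
adapted frequency `Λ(t) = 2 cos log(1−t)` does not converge.

This file: the variances `α = 2ν ω² ∫ₜ¹ ω⁻²`, `β = 2ν ω⁻¹ ∫ₜ¹ ω` (ODEs `α′ = 2dα − 2ν`, `β′ = −dβ − 2ν`, two-sided
comparability with `1 − t`, smoothness), and the spatial calculus of the anisotropic Gaussian `N(0, diag(a,b,b))` on `ℝ³`
(gradient, Laplacian).
-/

noncomputable section

namespace Summit.NavierStokesRegularity.NavierStokesRegularity.Theorems.AdaptedFrequencyConverges.Negative

open scoped Matrix InnerProductSpace RealInnerProductSpace Laplacian Topology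
open Literature.Analysis.FluidPDE Set Filter MeasureTheory Real intervalIntegral

/-! ### the two primitives -/

/-- `I₁(t) = ∫_t^1 ω(s)⁻² ds` [folklore] -/
def I1 (t : ℝ) : ℝ := ∫ s in t..1, (amp s ^ 2)⁻¹
/-- `I₂(t) = ∫_t^1 ω(s) ds` [folklore] -/
def I2 (t : ℝ) : ℝ := ∫ s in t..1, amp s

/-- `ω⁻² ≤ e²`. [folklore] -/
theorem amp_sq_inv_le (t : ℝ) : (amp t ^ 2)⁻¹ ≤ Real.exp 2 := by
  have h := le_amp t
  have h0 : 0 < Real.exp (-1) := Real.exp_pos _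
  calc (amp t ^ 2)⁻¹ ≤ (Real.exp (-1) ^ 2)⁻¹ :=
        inv_anti₀ (pow_pos h0 2) (pow_le_pow_left₀ h0.le h 2)
    _ = Real.exp 2 := by rw [← Real.exp_nat_mul, ← Real.exp_neg]; norm_num

/-- `e⁻² ≤ ω⁻²`. [folklore] -/
theorem le_amp_sq_inv (t : ℝ) : Real.exp (-2) ≤ (amp t ^ 2)⁻¹ := by
  have h := amp_le t
  calc Real.exp (-2) = (Real.exp 1 ^ 2)⁻¹ := by rw [← Real.exp_nat_mul, ← Real.exp_neg]; norm_num
    _ ≤ (amp t ^ 2)⁻¹ :=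
        inv_anti₀ (pow_pos (amp_pos t) 2) (pow_le_pow_left₀ (amp_pos t).le h 2)

/-- `ω⁻²` is measurable. [folklore] -/
theorem measurable_amp_sq_inv : Measurable (fun s => (amp s ^ 2)⁻¹) :=
  (measurable_amp.pow_const 2).inv

/-- `ω` is interval integrable (bounded and measurable). [folklore] -/
theorem intervalIntegrable_amp (a b : ℝ) : IntervalIntegrable amp volume a b := by
  refine (intervalIntegrable_const (c := Real.exp 1)).mono_fun' measurable_amp.aestronglyMeasurable ?_
  exact Eventually.of_forall fun s => by
    show ‖amp s‖ ≤ Real.exp 1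
    rw [Real.norm_of_nonneg (amp_pos s).le]; exact amp_le s

/-- `ω⁻²` is interval integrable (bounded and measurable). [folklore] -/
theorem intervalIntegrable_amp_sq_inv (a b : ℝ) :
    IntervalIntegrable (fun s => (amp s ^ 2)⁻¹) volume a b := by
  refine (intervalIntegrable_const (c := Real.exp 2)).mono_fun'
    measurable_amp_sq_inv.aestronglyMeasurable ?_
  exact Eventually.of_forall fun s => by
    show ‖(amp s ^ 2)⁻¹‖ ≤ Real.exp 2
    rw [Real.norm_of_nonneg (inv_nonneg.2 (sq_nonneg _))]; exact amp_sq_inv_le s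

/-- `I₂′ = −ω` below `1` (FTC at the lower limit). [folklore] -/
theorem hasDerivAt_I2 {t : ℝ} (ht : t < 1) : HasDerivAt I2 (-amp t) t := by
  unfold I2
  exact integral_hasDerivAt_left (intervalIntegrable_amp t 1)
    (continuousOn_amp.stronglyMeasurableAtFilter isOpen_Iio t ht) (continuousAt_amp ht)

/-- `I₁′ = −ω⁻²` below `1` (FTC at the lower limit). [folklore] -/
theorem hasDerivAt_I1 {t : ℝ} (ht : t < 1) : HasDerivAt I1 (-(amp t ^ 2)⁻¹) t := by
  unfold I1
  have hc : ContinuousOn (fun s => (amp s ^ 2)⁻¹) (Iio 1) := fun s hs =>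
    (((continuousAt_amp hs).pow 2).inv₀ (pow_pos (amp_pos s) 2).ne').continuousWithinAt
  exact integral_hasDerivAt_left (intervalIntegrable_amp_sq_inv t 1)
    (hc.stronglyMeasurableAtFilter isOpen_Iio t ht)
    (((continuousAt_amp ht).pow 2).inv₀ (pow_pos (amp_pos t) 2).ne')

/-- two-sided bounds [folklore] -/
theorem I2_bounds {t : ℝ} (ht : t ≤ 1) :
    Real.exp (-1) * (1 - t) ≤ I2 t ∧ I2 t ≤ Real.exp 1 * (1 - t) := by
  constructor
  · have := intervalIntegral.integral_mono_on ht (intervalIntegrable_const (c := Real.exp (-1)))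
      (intervalIntegrable_amp t 1) (fun s _ => le_amp s)
    simpa [I2, mul_comm] using this
  · have := intervalIntegral.integral_mono_on ht (intervalIntegrable_amp t 1)
      (intervalIntegrable_const (c := Real.exp 1)) (fun s _ => amp_le s)
    simpa [I2, mul_comm] using this

/-- `e⁻²(1−t) ≤ I₁(t) ≤ e²(1−t)` for `t ≤ 1`. [folklore] -/
theorem I1_bounds {t : ℝ} (ht : t ≤ 1) :
    Real.exp (-2) * (1 - t) ≤ I1 t ∧ I1 t ≤ Real.exp 2 * (1 - t) := by
  constructor
  · have := intervalIntegral.integral_mono_on ht (intervalIntegrable_const (c := Real.exp (-2)))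
      (intervalIntegrable_amp_sq_inv t 1) (fun s _ => le_amp_sq_inv s)
    simpa [I1, mul_comm] using this
  · have := intervalIntegral.integral_mono_on ht (intervalIntegrable_amp_sq_inv t 1)
      (intervalIntegrable_const (c := Real.exp 2)) (fun s _ => amp_sq_inv_le s)
    simpa [I1, mul_comm] using this

/-- `I₁ > 0` below `1`. [folklore] -/
theorem I1_pos {t : ℝ} (ht : t < 1) : 0 < I1 t :=
  lt_of_lt_of_le (mul_pos (Real.exp_pos _) (sub_pos.2 ht)) (I1_bounds ht.le).1
/-- `I₂ > 0` below `1`. [folklore] -/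
theorem I2_pos {t : ℝ} (ht : t < 1) : 0 < I2 t :=
  lt_of_lt_of_le (mul_pos (Real.exp_pos _) (sub_pos.2 ht)) (I2_bounds ht.le).1

/-- smoothness of the primitives on `(-∞, 1)` [folklore] -/
theorem contDiffOn_I2 : ContDiffOn ℝ (⊤ : ℕ∞) I2 (Iio 1) := by
  refine (contDiffOn_infty_iff_deriv_of_isOpen isOpen_Iio).2 ⟨?_, ?_⟩
  · exact fun t ht => (hasDerivAt_I2 ht).differentiableAt.differentiableWithinAt
  · have : ContDiffOn ℝ (⊤ : ℕ∞) (fun t => -amp t) (Iio 1) := fun t ht =>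
      (contDiffAt_amp ht).neg.contDiffWithinAt
    exact this.congr fun t ht => (hasDerivAt_I2 ht).deriv

/-- `I₁` is smooth on `(−∞, 1)` (its derivative is). [folklore] -/
theorem contDiffOn_I1 : ContDiffOn ℝ (⊤ : ℕ∞) I1 (Iio 1) := by
  refine (contDiffOn_infty_iff_deriv_of_isOpen isOpen_Iio).2 ⟨?_, ?_⟩
  · exact fun t ht => (hasDerivAt_I1 ht).differentiableAt.differentiableWithinAt
  · have : ContDiffOn ℝ (⊤ : ℕ∞) (fun t => -(amp t ^ 2)⁻¹) (Iio 1) := fun t ht =>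
      (((contDiffAt_amp ht).pow 2).inv (pow_pos (amp_pos t) 2).ne').neg.contDiffWithinAt
    exact this.congr fun t ht => (hasDerivAt_I1 ht).deriv

/-! ### the variances -/

/-- The axial variance `α(t) = 2ν ω(t)² ∫ₜ¹ ω⁻²` of the adapted kernel (solves `α′ = 2dα − 2ν`, `α(1⁻) = 0`). [folklore] -/
def varA (ν t : ℝ) : ℝ := 2 * ν * amp t ^ 2 * I1 t
/-- The transverse variance `β(t) = 2ν ω(t)⁻¹ ∫ₜ¹ ω` of the adapted kernel (solves `β′ = −dβ − 2ν`, `β(1⁻) = 0`). [folklore] -/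
def varB (ν t : ℝ) : ℝ := 2 * ν * (amp t)⁻¹ * I2 t

/-- **Variance ODE** `α′ = 2dα − 2ν`. [folklore] -/
theorem hasDerivAt_varA (ν : ℝ) {t : ℝ} (ht : t < 1) :
    HasDerivAt (varA ν) (2 * str t * varA ν t - 2 * ν) t := by
  have h := (((hasDerivAt_amp ht).pow 2).const_mul (2 * ν)).mul (hasDerivAt_I1 ht)
  refine h.congr_deriv ?_
  have ha : amp t ≠ 0 := (amp_pos t).ne'
  simp only [varA, Pi.pow_apply]
  field_simp
  ring

/-- **Variance ODE** `β′ = −dβ − 2ν`. [folklore] -/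
theorem hasDerivAt_varB (ν : ℝ) {t : ℝ} (ht : t < 1) :
    HasDerivAt (varB ν) (-(str t) * varB ν t - 2 * ν) t := by
  have ha : amp t ≠ 0 := (amp_pos t).ne'
  have h := (((hasDerivAt_amp ht).inv ha).const_mul (2 * ν)).mul (hasDerivAt_I2 ht)
  refine h.congr_deriv ?_
  simp only [varB, Pi.inv_apply]
  field_simp
  ring

/-- `2νe⁻⁴(1−t) ≤ α(t) ≤ 2νe⁴(1−t)`: the axial variance is comparable to `1 − t`. [folklore] -/
theorem varA_bounds {ν : ℝ} (hν : 0 ≤ ν) {t : ℝ} (ht : t ≤ 1) :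
    2 * ν * Real.exp (-4) * (1 - t) ≤ varA ν t ∧ varA ν t ≤ 2 * ν * Real.exp 4 * (1 - t) := by
  obtain ⟨h1, h2⟩ := I1_bounds ht
  have ha1 := amp_le t
  have ha2 := le_amp t
  have ha0 : 0 ≤ amp t := (amp_pos t).le
  have hI : 0 ≤ I1 t := h1.trans' (mul_nonneg (Real.exp_pos _).le (sub_nonneg.2 ht))
  have he : 0 ≤ Real.exp (-1) := (Real.exp_pos _).le
  have e1 : Real.exp (-4) = Real.exp (-1) ^ 2 * Real.exp (-2) := by
    rw [← Real.exp_nat_mul, ← Real.exp_add]; norm_num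
  have e2 : Real.exp 4 = Real.exp 1 ^ 2 * Real.exp 2 := by
    rw [← Real.exp_nat_mul, ← Real.exp_add]; norm_num
  constructor
  · rw [e1, varA]
    calc 2 * ν * (Real.exp (-1) ^ 2 * Real.exp (-2)) * (1 - t)
        = 2 * ν * Real.exp (-1) ^ 2 * (Real.exp (-2) * (1 - t)) := by ring
      _ ≤ 2 * ν * amp t ^ 2 * I1 t := by gcongr
  · rw [e2, varA]
    calc 2 * ν * amp t ^ 2 * I1 t ≤ 2 * ν * Real.exp 1 ^ 2 * (Real.exp 2 * (1 - t)) := by gcongr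
      _ = 2 * ν * (Real.exp 1 ^ 2 * Real.exp 2) * (1 - t) := by ring

/-- `2νe⁻²(1−t) ≤ β(t) ≤ 2νe²(1−t)`: the transverse variance is comparable to `1 − t`. [folklore] -/
theorem varB_bounds {ν : ℝ} (hν : 0 ≤ ν) {t : ℝ} (ht : t ≤ 1) :
    2 * ν * Real.exp (-2) * (1 - t) ≤ varB ν t ∧ varB ν t ≤ 2 * ν * Real.exp 2 * (1 - t) := by
  obtain ⟨h1, h2⟩ := I2_bounds ht
  have ha1 : (amp t)⁻¹ ≤ Real.exp 1 := by
    calc (amp t)⁻¹ ≤ (Real.exp (-1))⁻¹ := inv_anti₀ (Real.exp_pos _) (le_amp t)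
      _ = Real.exp 1 := by rw [← Real.exp_neg]; norm_num
  have ha2 : Real.exp (-1) ≤ (amp t)⁻¹ := by
    calc Real.exp (-1) = (Real.exp 1)⁻¹ := by rw [← Real.exp_neg]
      _ ≤ (amp t)⁻¹ := inv_anti₀ (amp_pos t) (amp_le t)
  have ha0 : 0 ≤ (amp t)⁻¹ := inv_nonneg.2 (amp_pos t).le
  have hI : 0 ≤ I2 t := h1.trans' (mul_nonneg (Real.exp_pos _).le (sub_nonneg.2 ht))
  have he : 0 ≤ Real.exp (-1) := (Real.exp_pos _).le
  have e1 : Real.exp (-2) = Real.exp (-1) * Real.exp (-1) := by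
    rw [← Real.exp_add]; norm_num
  have e2 : Real.exp 2 = Real.exp 1 * Real.exp 1 := by
    rw [← Real.exp_add]; norm_num
  constructor
  · rw [e1, varB]
    calc 2 * ν * (Real.exp (-1) * Real.exp (-1)) * (1 - t)
        = 2 * ν * Real.exp (-1) * (Real.exp (-1) * (1 - t)) := by ring
      _ ≤ 2 * ν * (amp t)⁻¹ * I2 t := by gcongr
  · rw [e2, varB]
    calc 2 * ν * (amp t)⁻¹ * I2 t ≤ 2 * ν * Real.exp 1 * (Real.exp 1 * (1 - t)) := by gcongr
      _ = 2 * ν * (Real.exp 1 * Real.exp 1) * (1 - t) := by ring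

/-- `α > 0` below `1`. [folklore] -/
theorem varA_pos {ν : ℝ} (hν : 0 < ν) {t : ℝ} (ht : t < 1) : 0 < varA ν t :=
  lt_of_lt_of_le (by have := Real.exp_pos (-4); have := sub_pos.2 ht; positivity)
    (varA_bounds hν.le ht.le).1

/-- `β > 0` below `1`. [folklore] -/
theorem varB_pos {ν : ℝ} (hν : 0 < ν) {t : ℝ} (ht : t < 1) : 0 < varB ν t :=
  lt_of_lt_of_le (by have := Real.exp_pos (-2); have := sub_pos.2 ht; positivity)
    (varB_bounds hν.le ht.le).1

/-- `α` is smooth on `(−∞, 1)`. [folklore] -/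
theorem contDiffOn_varA (ν : ℝ) : ContDiffOn ℝ (⊤ : ℕ∞) (varA ν) (Iio 1) := by
  have h1 : ContDiffOn ℝ (⊤ : ℕ∞) (fun t => 2 * ν * amp t ^ 2) (Iio 1) := fun t ht =>
    (contDiffAt_const.mul ((contDiffAt_amp ht).pow 2)).contDiffWithinAt
  exact h1.mul contDiffOn_I1

/-- `β` is smooth on `(−∞, 1)`. [folklore] -/
theorem contDiffOn_varB (ν : ℝ) : ContDiffOn ℝ (⊤ : ℕ∞) (varB ν) (Iio 1) := by
  have h1 : ContDiffOn ℝ (⊤ : ℕ∞) (fun t => 2 * ν * (amp t)⁻¹) (Iio 1) := fun t ht =>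
    (contDiffAt_const.mul ((contDiffAt_amp ht).inv (amp_pos t).ne')).contDiffWithinAt
  exact h1.mul contDiffOn_I2


/-! ## Part C1: anisotropic Gaussian, spatial calculus -/


/-! ### the anisotropic Gaussian with variances `a, b, b` -/

/-- The quadratic form `Q(x) = x₀²/(2a) + (x₁² + x₂²)/(2b)` of the anisotropic Gaussian. [folklore] -/
def gQ (a b : ℝ) (x : E3) : ℝ := (x 0) ^ 2 / (2 * a) + ((x 1) ^ 2 + (x 2) ^ 2) / (2 * b)
/-- Its normalising constant `(√(2πa) · 2πb)⁻¹`. [folklore] -/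
def gC (a b : ℝ) : ℝ := (Real.sqrt (2 * π * a) * (2 * π * b))⁻¹
/-- The anisotropic Gaussian density `N(0, diag(a, b, b))` on `ℝ³`. [folklore] -/
def gK (a b : ℝ) (x : E3) : ℝ := gC a b * Real.exp (-(gQ a b x))

/-- linear form `Q'(x) v = x₀v₀/a + (x₁v₁ + x₂v₂)/b` [folklore] -/
def gQ' (a b : ℝ) (x : E3) : E3 →L[ℝ] ℝ := (x 0 / a) • crd 0 + (x 1 / b) • crd 1 + (x 2 / b) • crd 2

/-- `Q′(x) v = x₀v₀/a + (x₁v₁ + x₂v₂)/b`. [folklore] -/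
@[simp] theorem gQ'_apply (a b : ℝ) (x v : E3) :
    gQ' a b x v = x 0 * v 0 / a + (x 1 * v 1 + x 2 * v 2) / b := by
  simp [gQ']; ring

/-- `DQ(x) = Q′(x)`. [folklore] -/
theorem hasFDerivAt_gQ (a b : ℝ) (x : E3) : HasFDerivAt (gQ a b) (gQ' a b x) x := by
  have h0 := ((crd 0).hasFDerivAt (x := x)).pow 2
  have h1 := ((crd 1).hasFDerivAt (x := x)).pow 2
  have h2 := ((crd 2).hasFDerivAt (x := x)).pow 2
  have h := (h0.mul_const (2 * a)⁻¹).add ((h1.add h2).mul_const (2 * b)⁻¹)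
  have h' : HasFDerivAt (gQ a b) _ x :=
    h.congr_of_eventuallyEq (Eventually.of_forall fun y => by simp [gQ, div_eq_mul_inv])
  refine h'.congr_fderiv ?_
  ext v
  simp
  ring

/-- `DK(x) = −K(x) Q′(x)`. [folklore] -/
theorem hasFDerivAt_gK (a b : ℝ) (x : E3) :
    HasFDerivAt (gK a b) ((-(gK a b x)) • gQ' a b x) x := by
  have h := ((hasFDerivAt_gQ a b x).neg.exp).const_mul (gC a b)
  have h' : HasFDerivAt (gK a b) _ x :=
    h.congr_of_eventuallyEq (Eventually.of_forall fun y => by simp [gK])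
  refine h'.congr_fderiv ?_
  ext v
  simp [gK]
  ring

/-- `DK(x) v = −K(x) (x₀v₀/a + (x₁v₁ + x₂v₂)/b)`. [folklore] -/
theorem fderiv_gK_apply (a b : ℝ) (x v : E3) :
    fderiv ℝ (gK a b) x v = -(gK a b x) * (x 0 * v 0 / a + (x 1 * v 1 + x 2 * v 2) / b) := by
  rw [(hasFDerivAt_gK a b x).fderiv]
  simp

/-- `Q` is smooth. [folklore] -/
theorem contDiff_gQ (a b : ℝ) {n : WithTop ℕ∞} : ContDiff ℝ n (gQ a b) := by
  have hc : ∀ i : Fin 3, ContDiff ℝ n (fun x : E3 => (x i) ^ 2) := fun i => (crd i).contDiff.pow 2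
  have := ((hc 0).div_const (2 * a)).add (((hc 1).add (hc 2)).div_const (2 * b))
  exact this

/-- `K` is smooth. [folklore] -/
theorem contDiff_gK (a b : ℝ) {n : WithTop ℕ∞} : ContDiff ℝ n (gK a b) :=
  contDiff_const.mul (contDiff_gQ a b).neg.exp

/-- `K` is differentiable. [folklore] -/
theorem differentiableAt_gK (a b : ℝ) (x : E3) : DifferentiableAt ℝ (gK a b) x :=
  (hasFDerivAt_gK a b x).differentiableAt

/-- pure second partials: `∂ᵢ∂ᵢ K = K ((xᵢ/γᵢ)² − 1/γᵢ)` [folklore] -/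
theorem fderiv_fderiv_gK_single (a b : ℝ) (x : E3) (i : Fin 3) :
    fderiv ℝ (fun w => fderiv ℝ (gK a b) w (EuclideanSpace.single i 1)) x (EuclideanSpace.single i 1) =
      gK a b x * ((x i / (if i = 0 then a else b)) ^ 2 - 1 / (if i = 0 then a else b)) := by
  -- the first partial as a product of two scalar functions
  have hfun : (fun w => fderiv ℝ (gK a b) w (EuclideanSpace.single i 1)) =
      fun w => -(gK a b w) * (w i / (if i = 0 then a else b)) := by
    funext w
    rw [fderiv_gK_apply]
    fin_cases i <;> simp
  rw [hfun]
  have hG : HasFDerivAt (fun w => -(gK a b w)) _ x := (hasFDerivAt_gK a b x).neg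
  have hc : HasFDerivAt (fun w : E3 => w i / (if i = 0 then a else b))
      (((if i = 0 then a else b))⁻¹ • crd i) x := by
    have := ((crd i).hasFDerivAt (x := x)).mul_const ((if i = 0 then a else b))⁻¹
    refine (this.congr_of_eventuallyEq (Eventually.of_forall fun y => by
      simp [div_eq_mul_inv])).congr_fderiv ?_
    ext v; simp
  have hm : HasFDerivAt (fun w => -(gK a b w) * (w i / (if i = 0 then a else b))) _ x := hG.mul hc
  rw [hm.fderiv]
  fin_cases i <;> simp <;> ring

/-- **Laplacian of the anisotropic Gaussian**: `ΔK = K (x₀²/a² + (x₁² + x₂²)/b² − 1/a − 2/b)`. [folklore] -/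
theorem laplacian_gK (a b : ℝ) (x : E3) :
    (Δ (gK a b)) x = gK a b x * ((x 0 / a) ^ 2 + (x 1 / b) ^ 2 + (x 2 / b) ^ 2 - 1 / a - 2 / b) := by
  rw [laplacian_eq_sum_fderiv_fderiv (EuclideanSpace.basisFun (Fin 3) ℝ) (contDiff_gK a b)]
  simp only [EuclideanSpace.basisFun_apply, fderiv_fderiv_gK_single, Fin.sum_univ_three]
  simp
  ring

/-- `K > 0` for positive variances. [folklore] -/
theorem gK_pos {a b : ℝ} (ha : 0 < a) (hb : 0 < b) (x : E3) : 0 < gK a b x := by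
  unfold gK gC
  positivity



end Summit.NavierStokesRegularity.NavierStokesRegularity.Theorems.AdaptedFrequencyConverges.Negative

end
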